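import Mathlib
import HarnessLib
import Literature.Analysis.FluidPDE.SlabPressureNormalization
import Literature.Analysis.FluidPDE.LocalTypeIReverseTools
import Literature.Analysis.FluidPDE.SuitableWeakInBallTools
import Literature.Analysis.FluidPDE.SuitableWeakPressure

/-!
# Blow-up at a local Type I singular point (Albritton–Barker 2019, Thm. 1.1, forward direction;
# Seregin–Šverák 2009, Thm. 2.8), file 4:
# pressure normalisation and `L³ × L^{3/2}` bounds on balls from Albritton–Barker's `𝐈`

Analysis/FluidPDE proof file (theorems only: no definition, no named fact, no `sorry`).  PORT NOTE: this
module is the Literature twin of the Summits-side file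
`Summits/NavierStokesRegularity/NavierStokesRegularity/Theorems/HardyPointSinkABForwardHardyNormalization.lean` (prover
seats of route HardyPointSink, landed 2026-08-16, kernel-checked), carried over verbatim up to the namespace
(`Literature.Analysis.FluidPDE.LocalTypeIBlowup`, topic-aligned) and the provenance tags, so that the Literature named
facts `Literature.Analysis.FluidPDE.AlbrittonBarkerForward` (`LocalTypeICharacterization.lean`) and
`Literature.Analysis.FluidPDE.AlbrittonBarkerTypeICharacterization` (`LocalTypeI.lean`) are discharged INSIDE
`Literature/` (`AlbrittonBarkerForwardHolds.lean`), where `LocalTypeICharacterizationHolds.lean` asks for them; the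
Summits copies are the dedup candidates of record (librarian pattern (b), promote request filed 2026-08-26).
The mathematics is the published blow-up procedure at a local Type I singular point (Seregin–Šverák 2009, §2 and
Thm. 2.8; Albritton–Barker 2019, Prop. 2.4 and §3); nothing here is a claim about Navier–Stokes regularity.

Fourth helper file for the forward direction of Albritton–Barker 2019, Thm. 1.1.  The tree's
`SlabPressureNormalization.lean` normalises the pressure of a suitable weak solution on the
**slab** `ℝ³ × ℝ₋` to unit-ball mean zero and bounds `‖v‖_{L³(Q(0,a))}`, `‖q‖_{L^{3/2}(Q(0,a))}`
by `𝐈` (Albritton–Barker 2019, §3, (3.3)).  The rescaled solutions of a blow-up sequence at a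
local singularity live on balls only; this file records the same bookkeeping for a pair given
on a ball `Q(0, a)`:

* `lintegral_pressure_ball_le`, `eLpNorm_pressure_ball_le` — for a unit-ball-mean-free pressure
  `q` measurable on `Q(0, a)`, `a ≥ 1`: `∫_{Q(0,a)} |q|^{3/2} ≤ 2 (1 + |B_a|/|B_1|) a² D(Q(0,a); q)`
  (no slice integrability is assumed: at times where `q(t)` is not integrable on `B_a` the
  Bochner means vanish and the estimate is trivial);
* `eLpNorm_velocity_ball_le` — `‖v‖_{L³(Q(0,a))} ≤ (a² 𝐈(ω))^{1/3}` for `Q(0, a) ⊆ ω`;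
* `memLp_unitBallMean`, `IsSuitableWeakSolutionInBall.sub_unitBallMean` — the unit-ball mean of
  an `L^{3/2}(Q(0,a))` pressure is in `L^{3/2}(Q(0,a))`, and subtracting it keeps Albritton–
  Barker's class Def. 2.1 on the ball (`IsSuitableWeakSolutionOn.sub_pressure`);
* `abScaledSum_sub_unitBallMean_ball`, `typeIBound_sub_unitBallMean_ball` — `A + C + D + E` and
  `𝐈(Q(0,a))` do not see the normalisation (`cknDOsc_sub_fun_time_of_integrableOn`).

## References

* D. Albritton, T. Barker, J. Math. Fluid Mech. 21 (2019) = arXiv:1811.00502, Def. 2.1, §3 (3.3).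
-/

noncomputable section

open MeasureTheory Set Function Filter Topology TopologicalSpace Metric
open scoped NNReal ENNReal
open Literature.Analysis Literature.Analysis.FluidPDE

namespace Literature.Analysis.FluidPDE.LocalTypeIBlowup


/-! ### The parabolic ball `Q(0, a)` as a product and its finite measure -/

/-- `Q(0, a) = (-a², 0) × B(0, a)`. [folklore] -/
private theorem parabolicCylinder_zero_eq (a : ℝ) :
    parabolicCylinder a (0 : ℝ × (EuclideanSpace ℝ (Fin 3))) = Ioo (-a ^ 2) 0 ×ˢ ball (0 : (EuclideanSpace ℝ (Fin 3))) a := by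
  simp [parabolicCylinder]

/-- Parabolic cylinders have finite Lebesgue measure. [folklore] -/
private theorem volume_parabolicCylinder_lt_top (r : ℝ) (z : ℝ × (EuclideanSpace ℝ (Fin 3))) :
    volume (parabolicCylinder r z) < ∞ :=
  lt_of_le_of_lt (measure_mono (parabolicCylinder_subset_Icc_prod_closedBall z r))
    (isCompact_Icc_prod_closedBall z r).measure_lt_top

/-- Lebesgue measure restricted to a parabolic cylinder is finite. [folklore] -/
private theorem isFiniteMeasure_restrict_parabolicCylinder (r : ℝ) (z : ℝ × (EuclideanSpace ℝ (Fin 3))) :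
    IsFiniteMeasure (volume.restrict (parabolicCylinder r z)) :=
  ⟨by rw [Measure.restrict_apply_univ]; exact volume_parabolicCylinder_lt_top r z⟩

/-! ### The unit-ball mean of a ball pressure -/

section Mean

variable {q : ℝ → (EuclideanSpace ℝ (Fin 3)) → ℝ} {a : ℝ}

/-- Measurability of the time-dependent unit-ball mean `(t, x) ↦ [q]_{B(0,1)}(t)` on `Q(0, a)`,
`a ≥ 1`, for `q` measurable on `Q(0, a)`. [folklore] -/
private theorem aestronglyMeasurable_unitBallMean (ha : 1 ≤ a)
    (hqm : AEStronglyMeasurable (uncurry q) (volume.restrict (parabolicCylinder a (0 : ℝ × (EuclideanSpace ℝ (Fin 3)))))) :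
    AEStronglyMeasurable (fun w : ℝ × (EuclideanSpace ℝ (Fin 3)) => ⨍ y in ball (0 : (EuclideanSpace ℝ (Fin 3))) 1, q w.1 y)
      (volume.restrict (parabolicCylinder a (0 : ℝ × (EuclideanSpace ℝ (Fin 3))))) := by
  rw [parabolicCylinder_zero_eq] at hqm ⊢
  have hqB : AEStronglyMeasurable (uncurry q)
      ((volume.restrict (Ioo (-a ^ 2) 0)).prod (volume.restrict (ball (0 : (EuclideanSpace ℝ (Fin 3))) 1))) := by
    rw [← volume_restrict_prod_eq]
    exact hqm.mono_measure (Measure.restrict_mono (Set.prod_mono Subset.rfl (ball_subset_ball ha)) le_rfl)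
  have h := hqB.integral_prod_right'
  simp only [uncurry_apply_pair] at h
  simp_rw [setAverage_eq]
  rw [volume_restrict_prod_eq]
  exact (h.const_smul ((volume : Measure (EuclideanSpace ℝ (Fin 3))).real (ball (0 : (EuclideanSpace ℝ (Fin 3))) 1))⁻¹).comp_quasiMeasurePreserving
    Measure.quasiMeasurePreserving_fst

/-- **The unit-ball mean of an `L^{3/2}(Q(0,a))` pressure is in `L^{3/2}(Q(0,a))`** (`a ≥ 1`;
Jensen on the slices, `lintegral_enorm_setAverage_slice_rpow_le_of_subset`), with the explicit
bound `∫ |[q]_{B_1}|^{3/2} ≤ |B_a| |B_1|⁻¹ ∫_{Q(0,a)} |q|^{3/2}`. [folklore] -/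
private theorem lintegral_unitBallMean_le (ha : 1 ≤ a)
    (hqm : AEStronglyMeasurable (uncurry q) (volume.restrict (parabolicCylinder a (0 : ℝ × (EuclideanSpace ℝ (Fin 3)))))) :
    ∫⁻ w in parabolicCylinder a (0 : ℝ × (EuclideanSpace ℝ (Fin 3))), ‖⨍ y in ball (0 : (EuclideanSpace ℝ (Fin 3))) 1, q w.1 y‖ₑ ^ (3 / 2 : ℝ) ≤
      volume (ball (0 : (EuclideanSpace ℝ (Fin 3))) a) * (volume (ball (0 : (EuclideanSpace ℝ (Fin 3))) 1))⁻¹ *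
        ∫⁻ w in parabolicCylinder a (0 : ℝ × (EuclideanSpace ℝ (Fin 3))), ‖q w.1 w.2‖ₑ ^ (3 / 2 : ℝ) := by
  rw [parabolicCylinder_zero_eq] at hqm ⊢
  refine (lintegral_enorm_setAverage_slice_rpow_le_of_subset measure_ball_lt_top.ne
    (ball_subset_ball ha) (by norm_num) hqm).trans ?_
  exact mul_le_mul_right (lintegral_mono_set (Set.prod_mono Subset.rfl (ball_subset_ball ha))) _

/-- `L^{3/2}` class of the unit-ball mean on `Q(0, a)`. [folklore] -/
private theorem memLp_unitBallMean (ha : 1 ≤ a)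
    (hq : MemLp (uncurry q) (3 / 2) (volume.restrict (parabolicCylinder a (0 : ℝ × (EuclideanSpace ℝ (Fin 3)))))) :
    MemLp (fun w : ℝ × (EuclideanSpace ℝ (Fin 3)) => ⨍ y in ball (0 : (EuclideanSpace ℝ (Fin 3))) 1, q w.1 y) (3 / 2)
      (volume.restrict (parabolicCylinder a (0 : ℝ × (EuclideanSpace ℝ (Fin 3))))) := by
  obtain ⟨h32, h32', h32r⟩ := threeHalves_facts
  refine ⟨aestronglyMeasurable_unitBallMean ha hq.1, ?_⟩
  rw [eLpNorm_eq_lintegral_rpow_enorm_toReal (zero_lt_one.trans_le h32).ne' h32', h32r]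
  refine ENNReal.rpow_lt_top_of_nonneg (by positivity) (lt_of_le_of_lt (lintegral_unitBallMean_le ha hq.1) ?_).ne
  have hfin : ∫⁻ w in parabolicCylinder a (0 : ℝ × (EuclideanSpace ℝ (Fin 3))), ‖q w.1 w.2‖ₑ ^ (3 / 2 : ℝ) < ∞ := by
    have h := hq.2
    rw [eLpNorm_eq_lintegral_rpow_enorm_toReal (zero_lt_one.trans_le h32).ne' h32', h32r] at h
    have h' := ENNReal.rpow_lt_top_of_nonneg (show (0 : ℝ) ≤ 3 / 2 by norm_num) h.ne
    rw [← ENNReal.rpow_mul, show (1 / (3 / 2 : ℝ)) * (3 / 2) = 1 by norm_num, ENNReal.rpow_one] at h'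
    exact h'
  exact ENNReal.mul_lt_top (ENNReal.mul_lt_top measure_ball_lt_top
    (ENNReal.inv_lt_top.2 (measure_ball_pos volume (0 : (EuclideanSpace ℝ (Fin 3))) one_pos))) hfin

/-- **Subtracting the unit-ball mean keeps Albritton–Barker's class on the ball** `Q(0, a)`,
`a ≥ 1` (`IsSuitableWeakSolutionOn.sub_pressure` for the local notion; the energy and gradient
classes are untouched; the pressure class by `memLp_unitBallMean`). [cite: AlbrittonBarker2019, §2 (the pressure is determined up to a function of time; mean-zero normalisation on balls in the quantity D)] -/
theorem isSuitableWeakSolutionInBall_sub_unitBallMean {v : ℝ → (EuclideanSpace ℝ (Fin 3)) → (EuclideanSpace ℝ (Fin 3))} (ha : 1 ≤ a)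
    (h : IsSuitableWeakSolutionInBall a (0 : ℝ × (EuclideanSpace ℝ (Fin 3))) v q) :
    IsSuitableWeakSolutionInBall a (0 : ℝ × (EuclideanSpace ℝ (Fin 3))) v
      (fun t x => q t x - ⨍ y in ball (0 : (EuclideanSpace ℝ (Fin 3))) 1, q t y) := by
  obtain ⟨hsw, hen, hgr, hq⟩ := h
  obtain ⟨h32, h32', h32r⟩ := threeHalves_facts
  haveI := isFiniteMeasure_restrict_parabolicCylinder a (0 : ℝ × (EuclideanSpace ℝ (Fin 3)))
  have hm := memLp_unitBallMean ha hq
  have hint : IntegrableOn (fun w : ℝ × (EuclideanSpace ℝ (Fin 3)) => ⨍ y in ball (0 : (EuclideanSpace ℝ (Fin 3))) 1, q w.1 y)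
      (parabolicCylinder a (0 : ℝ × (EuclideanSpace ℝ (Fin 3)))) volume :=
    (hm.mono_exponent h32).integrable le_rfl
  refine ⟨hsw.sub_pressure hint.locallyIntegrableOn fun K hK hKc => ?_, hen, hgr, ?_⟩
  · have h1 : ∫⁻ z in K, ‖⨍ y in ball (0 : (EuclideanSpace ℝ (Fin 3))) 1, q z.1 y‖ₑ ^ (3 / 2 : ℝ) ≤
        ∫⁻ z in parabolicCylinder a (0 : ℝ × (EuclideanSpace ℝ (Fin 3))), ‖⨍ y in ball (0 : (EuclideanSpace ℝ (Fin 3))) 1, q z.1 y‖ₑ ^ (3 / 2 : ℝ) :=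
      lintegral_mono_set hK
    refine lt_of_le_of_lt h1 ?_
    have h2 := hm.2
    rw [eLpNorm_eq_lintegral_rpow_enorm_toReal (zero_lt_one.trans_le h32).ne' h32', h32r] at h2
    have h3 := ENNReal.rpow_lt_top_of_nonneg (show (0 : ℝ) ≤ 3 / 2 by norm_num) h2.ne
    rw [← ENNReal.rpow_mul, show (1 / (3 / 2 : ℝ)) * (3 / 2) = 1 by norm_num, ENNReal.rpow_one] at h3
    exact h3
  · have e : uncurry (fun t x => q t x - ⨍ y in ball (0 : (EuclideanSpace ℝ (Fin 3))) 1, q t y) =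
        uncurry q - fun w : ℝ × (EuclideanSpace ℝ (Fin 3)) => ⨍ y in ball (0 : (EuclideanSpace ℝ (Fin 3))) 1, q w.1 y := rfl
    rw [e]
    exact hq.sub hm

/-- The normalised pressure has unit-ball mean zero at every time (junk cases included). [cite: AlbrittonBarker2019, §2 (mean-zero pressure normalisation on balls)] -/
theorem unitBallMean_normalised (q : ℝ → (EuclideanSpace ℝ (Fin 3)) → ℝ) (t : ℝ) :
    ⨍ y in ball (0 : (EuclideanSpace ℝ (Fin 3))) 1, (q t y - ⨍ y' in ball (0 : (EuclideanSpace ℝ (Fin 3))) 1, q t y') = 0 :=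
  unitBallMean_sub_unitBallMean q t

end Mean

/-! ### `L^{3/2}` bound of a unit-ball-mean-free pressure by `D` -/

section PressureBound

variable {q : ℝ → (EuclideanSpace ℝ (Fin 3)) → ℝ} {a : ℝ}

/-- **`∫_{Q(0,a)} |q|^{3/2} ≤ 2 (1 + |B_a|/|B_1|) a² D(Q(0,a); q)`** for a pressure with
`[q]_{B(0,1)}(t) = 0` for all `t`, measurable on `Q(0, a)`, `a ≥ 1` (ball version of the tree's
`lintegral_pressure_le_of_unitBallMean_eq_zero`: split `q = (q - [q]_{B_a}) + [q]_{B_a}`; at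
times where `q(t)` is integrable on `B_a`, `[q]_{B_a}(t) = -[q - [q]_{B_a}(t)]_{B_1}` is bounded
by Jensen, and at the other times the mean vanishes). [cite: AlbrittonBarker2019, §3 (3.3)] -/
theorem lintegral_pressure_ball_le (ha : 1 ≤ a)
    (hqm : AEStronglyMeasurable (uncurry q) (volume.restrict (parabolicCylinder a (0 : ℝ × (EuclideanSpace ℝ (Fin 3))))))
    (h0 : ∀ t, ⨍ y in ball (0 : (EuclideanSpace ℝ (Fin 3))) 1, q t y = 0) :
    ∫⁻ w in parabolicCylinder a (0 : ℝ × (EuclideanSpace ℝ (Fin 3))), ‖q w.1 w.2‖ₑ ^ (3 / 2 : ℝ) ≤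
      2 * (1 + volume (ball (0 : (EuclideanSpace ℝ (Fin 3))) a) * (volume (ball (0 : (EuclideanSpace ℝ (Fin 3))) 1))⁻¹) *
        (ENNReal.ofReal a ^ 2 * cknDOsc a 0 q) := by
  have ha0 : 0 < a := one_pos.trans_le ha
  set I : Set ℝ := Ioo (-a ^ 2) 0 with hI
  set Ba : Set (EuclideanSpace ℝ (Fin 3)) := ball (0 : (EuclideanSpace ℝ (Fin 3))) a with hBa
  set B1 : Set (EuclideanSpace ℝ (Fin 3)) := ball (0 : (EuclideanSpace ℝ (Fin 3))) 1 with hB1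
  have hB1a : B1 ⊆ Ba := ball_subset_ball ha
  have hQ : parabolicCylinder a (0 : ℝ × (EuclideanSpace ℝ (Fin 3))) = I ×ˢ Ba := parabolicCylinder_zero_eq a
  set m : ℝ → ℝ := fun t => ⨍ y in Ba, q t y with hm
  -- the mean-free part: `∫_Q ‖q - [q]_{B_a}‖^{3/2} = a² D`
  have hD : ∫⁻ w in parabolicCylinder a (0 : ℝ × (EuclideanSpace ℝ (Fin 3))), ‖q w.1 w.2 - m w.1‖ₑ ^ (3 / 2 : ℝ) =
      ENNReal.ofReal a ^ 2 * cknDOsc a 0 q := by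
    have ha2 : ENNReal.ofReal a ^ 2 ≠ 0 := pow_ne_zero _ (ENNReal.ofReal_pos.2 ha0).ne'
    have ha2' : ENNReal.ofReal a ^ 2 ≠ ∞ := ENNReal.pow_ne_top ENNReal.ofReal_ne_top
    unfold cknDOsc
    rw [← mul_assoc, ENNReal.mul_inv_cancel ha2 ha2', one_mul]
    rfl
  -- the means are controlled by averages over `B_1` of the mean-free part
  have hB1pos : volume B1 ≠ 0 := (measure_ball_pos volume (0 : (EuclideanSpace ℝ (Fin 3))) one_pos).ne'
  have hmean : ∀ t, ‖m t‖ₑ ≤ ‖⨍ y in B1, (q t y - m t)‖ₑ := by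
    intro t
    by_cases hint : IntegrableOn (q t) Ba volume
    · rw [FunctionSpaces.setAverage_sub_const hB1pos measure_ball_lt_top.ne (hint.mono_set hB1a)
        (m t), h0 t, zero_sub, enorm_neg]
    · have : m t = 0 := by
        simp only [hm, setAverage_eq, integral_undef hint, smul_zero]
      rw [this, enorm_zero]
      exact bot_le
  -- measurability on the cylinder
  have hpm : AEStronglyMeasurable (uncurry q) (volume.restrict (I ×ˢ Ba)) := by rwa [← hQ]
  have hfm : AEStronglyMeasurable (uncurry fun t y => q t y - m t) (volume.restrict (I ×ˢ Ba)) := by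
    have hmm := aestronglyMeasurable_setAverage_slice hpm
    have e : uncurry (fun t y => q t y - m t) = uncurry q - fun w : ℝ × (EuclideanSpace ℝ (Fin 3)) => m w.1 := rfl
    rw [e]
    exact hpm.sub hmm
  -- the means, integrated over `Q(0, a)`
  have h2 : ∫⁻ w in parabolicCylinder a (0 : ℝ × (EuclideanSpace ℝ (Fin 3))), ‖m w.1‖ₑ ^ (3 / 2 : ℝ) ≤
      volume Ba * (volume B1)⁻¹ * (ENNReal.ofReal a ^ 2 * cknDOsc a 0 q) := by
    have e : ∫⁻ w in I ×ˢ Ba, ‖m w.1‖ₑ ^ (3 / 2 : ℝ) ≤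
        ∫⁻ w in I ×ˢ Ba, ‖⨍ y in B1, (q w.1 y - m w.1)‖ₑ ^ (3 / 2 : ℝ) :=
      lintegral_mono fun w => ENNReal.rpow_le_rpow (hmean w.1) (by norm_num)
    rw [hQ]
    refine e.trans ?_
    refine (lintegral_enorm_setAverage_slice_rpow_le_of_subset measure_ball_lt_top.ne hB1a
      (by norm_num) hfm).trans ?_
    gcongr
    rw [← hD, hQ]
    exact lintegral_mono_set (Set.prod_mono Subset.rfl hB1a)
  -- pointwise splitting `|q|^{3/2} ≤ 2 (|q - m|^{3/2} + |m|^{3/2})`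
  have hpt : ∀ w : ℝ × (EuclideanSpace ℝ (Fin 3)), ‖q w.1 w.2‖ₑ ^ (3 / 2 : ℝ) ≤
      2 * (‖q w.1 w.2 - m w.1‖ₑ ^ (3 / 2 : ℝ) + ‖m w.1‖ₑ ^ (3 / 2 : ℝ)) := by
    intro w
    have hsum : ‖q w.1 w.2‖ₑ ≤ ‖q w.1 w.2 - m w.1‖ₑ + ‖m w.1‖ₑ := by
      calc ‖q w.1 w.2‖ₑ = ‖(q w.1 w.2 - m w.1) + m w.1‖ₑ := by rw [sub_add_cancel]
        _ ≤ ‖q w.1 w.2 - m w.1‖ₑ + ‖m w.1‖ₑ := enorm_add_le _ _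
    calc ‖q w.1 w.2‖ₑ ^ (3 / 2 : ℝ) ≤ (‖q w.1 w.2 - m w.1‖ₑ + ‖m w.1‖ₑ) ^ (3 / 2 : ℝ) :=
          ENNReal.rpow_le_rpow hsum (by norm_num)
      _ ≤ 2 ^ ((3 / 2 : ℝ) - 1) * (‖q w.1 w.2 - m w.1‖ₑ ^ (3 / 2 : ℝ) + ‖m w.1‖ₑ ^ (3 / 2 : ℝ)) :=
          ENNReal.rpow_add_le_mul_rpow_add_rpow _ _ (by norm_num)
      _ ≤ 2 * (‖q w.1 w.2 - m w.1‖ₑ ^ (3 / 2 : ℝ) + ‖m w.1‖ₑ ^ (3 / 2 : ℝ)) := by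
          gcongr
          calc (2 : ℝ≥0∞) ^ ((3 / 2 : ℝ) - 1) ≤ 2 ^ (1 : ℝ) :=
                ENNReal.rpow_le_rpow_of_exponent_le (by norm_num) (by norm_num)
            _ = 2 := ENNReal.rpow_one 2
  have hmeas1 : AEMeasurable (fun w : ℝ × (EuclideanSpace ℝ (Fin 3)) => ‖q w.1 w.2 - m w.1‖ₑ ^ (3 / 2 : ℝ))
      (volume.restrict (parabolicCylinder a (0 : ℝ × (EuclideanSpace ℝ (Fin 3))))) := by
    rw [hQ]; exact hfm.aemeasurable.enorm.pow_const _
  calc ∫⁻ w in parabolicCylinder a (0 : ℝ × (EuclideanSpace ℝ (Fin 3))), ‖q w.1 w.2‖ₑ ^ (3 / 2 : ℝ)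
      ≤ ∫⁻ w in parabolicCylinder a (0 : ℝ × (EuclideanSpace ℝ (Fin 3))),
          2 * (‖q w.1 w.2 - m w.1‖ₑ ^ (3 / 2 : ℝ) + ‖m w.1‖ₑ ^ (3 / 2 : ℝ)) := lintegral_mono hpt
    _ = 2 * ((∫⁻ w in parabolicCylinder a (0 : ℝ × (EuclideanSpace ℝ (Fin 3))), ‖q w.1 w.2 - m w.1‖ₑ ^ (3 / 2 : ℝ)) +
          ∫⁻ w in parabolicCylinder a (0 : ℝ × (EuclideanSpace ℝ (Fin 3))), ‖m w.1‖ₑ ^ (3 / 2 : ℝ)) := by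
        rw [lintegral_const_mul' _ _ (by norm_num), lintegral_add_left' hmeas1]
    _ ≤ 2 * (ENNReal.ofReal a ^ 2 * cknDOsc a 0 q +
          volume Ba * (volume B1)⁻¹ * (ENNReal.ofReal a ^ 2 * cknDOsc a 0 q)) := by
        rw [hD]; gcongr
    _ = 2 * (1 + volume Ba * (volume B1)⁻¹) * (ENNReal.ofReal a ^ 2 * cknDOsc a 0 q) := by ring

/-- **`‖q‖_{L^{3/2}(Q(0,a))} ≤ (2 (1 + |B_a|/|B_1|) a² 𝐈(ω))^{2/3}`** for a unit-ball-mean-free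
pressure measurable on `Q(0, a) ⊆ ω`, `a ≥ 1`. [cite: AlbrittonBarker2019, §3 (3.3)] -/
theorem eLpNorm_pressure_ball_le (ha : 1 ≤ a)
    (hqm : AEStronglyMeasurable (uncurry q) (volume.restrict (parabolicCylinder a (0 : ℝ × (EuclideanSpace ℝ (Fin 3))))))
    (h0 : ∀ t, ⨍ y in ball (0 : (EuclideanSpace ℝ (Fin 3))) 1, q t y = 0) {ω : Set (ℝ × (EuclideanSpace ℝ (Fin 3)))}
    (hω : parabolicCylinder a (0 : ℝ × (EuclideanSpace ℝ (Fin 3))) ⊆ ω) (v : ℝ → (EuclideanSpace ℝ (Fin 3)) → (EuclideanSpace ℝ (Fin 3))) (G : ℝ → (EuclideanSpace ℝ (Fin 3)) → (EuclideanSpace ℝ (Fin 3)) →L[ℝ] (EuclideanSpace ℝ (Fin 3))) :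
    eLpNorm (uncurry q) (3 / 2) (volume.restrict (parabolicCylinder a (0 : ℝ × (EuclideanSpace ℝ (Fin 3))))) ≤
      (2 * (1 + volume (ball (0 : (EuclideanSpace ℝ (Fin 3))) a) * (volume (ball (0 : (EuclideanSpace ℝ (Fin 3))) 1))⁻¹) *
        (ENNReal.ofReal a ^ 2 * typeIBound ω v q G)) ^ (2 / 3 : ℝ) := by
  obtain ⟨h32, h32', h32r⟩ := threeHalves_facts
  have ha0 : 0 < a := one_pos.trans_le ha
  have hD : cknDOsc a 0 q ≤ typeIBound ω v q G :=
    (cknDOsc_le_abScaledSum (u := v) (G := G)).trans (abScaledSum_le_typeIBound ha0 hω)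
  rw [eLpNorm_eq_lintegral_rpow_enorm_toReal (zero_lt_one.trans_le h32).ne' h32', h32r,
    show (1 / (3 / 2 : ℝ)) = 2 / 3 by norm_num]
  refine ENNReal.rpow_le_rpow ?_ (by norm_num)
  refine (lintegral_pressure_ball_le ha hqm h0).trans ?_
  gcongr

end PressureBound

/-! ### `L³` bound of the velocity by `C` -/

/-- **`‖v‖_{L³(Q(0,a))} ≤ (a² 𝐈(ω))^{1/3}`** whenever `Q(0, a) ⊆ ω` (`C(Q(0,a)) ≤ 𝐈(ω)`).
[cite: AlbrittonBarker2019, §3 (3.3)] -/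
theorem eLpNorm_velocity_ball_le {v : ℝ → (EuclideanSpace ℝ (Fin 3)) → (EuclideanSpace ℝ (Fin 3))} {a : ℝ} (ha : 0 < a) {ω : Set (ℝ × (EuclideanSpace ℝ (Fin 3)))}
    (hω : parabolicCylinder a (0 : ℝ × (EuclideanSpace ℝ (Fin 3))) ⊆ ω) (q : ℝ → (EuclideanSpace ℝ (Fin 3)) → ℝ) (G : ℝ → (EuclideanSpace ℝ (Fin 3)) → (EuclideanSpace ℝ (Fin 3)) →L[ℝ] (EuclideanSpace ℝ (Fin 3))) :
    eLpNorm (uncurry v) 3 (volume.restrict (parabolicCylinder a (0 : ℝ × (EuclideanSpace ℝ (Fin 3))))) ≤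
      (ENNReal.ofReal a ^ 2 * typeIBound ω v q G) ^ (1 / 3 : ℝ) := by
  have ha2 : ENNReal.ofReal a ^ 2 ≠ 0 := pow_ne_zero _ (ENNReal.ofReal_pos.2 ha).ne'
  have ha2' : ENNReal.ofReal a ^ 2 ≠ ∞ := ENNReal.pow_ne_top ENNReal.ofReal_ne_top
  have hC : cknC a 0 v ≤ typeIBound ω v q G :=
    (cknC_le_abScaledSum (p := q) (G := G)).trans (abScaledSum_le_typeIBound ha hω)
  unfold cknC at hC
  have h' := (ENNReal.inv_mul_le_iff ha2 ha2').1 hC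
  rw [eLpNorm_eq_lintegral_rpow_enorm_toReal (by norm_num) (by norm_num), ENNReal.toReal_ofNat]
  refine ENNReal.rpow_le_rpow ?_ (by norm_num)
  refine le_of_eq_of_le (lintegral_congr fun w => ?_) h'
  show ‖v w.1 w.2‖ₑ ^ (3 : ℝ) = ‖v w.1 w.2‖ₑ ^ (3 : ℕ)
  rw [← ENNReal.rpow_natCast]
  norm_num

/-! ### `𝐈` does not see the normalisation -/

/-- On sub-balls of `Q(0, a)`, where the pressure is `L^{3/2}`, `A + C + D + E` is unchanged by
subtracting the unit-ball mean. [cite: AlbrittonBarker2019, §1] -/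
theorem abScaledSum_sub_unitBallMean_ball {v : ℝ → (EuclideanSpace ℝ (Fin 3)) → (EuclideanSpace ℝ (Fin 3))} {q : ℝ → (EuclideanSpace ℝ (Fin 3)) → ℝ}
    {G : ℝ → (EuclideanSpace ℝ (Fin 3)) → (EuclideanSpace ℝ (Fin 3)) →L[ℝ] (EuclideanSpace ℝ (Fin 3))} {a : ℝ}
    (hq : MemLp (uncurry q) (3 / 2) (volume.restrict (parabolicCylinder a (0 : ℝ × (EuclideanSpace ℝ (Fin 3))))))
    {r : ℝ} (hr : 0 < r) {z : ℝ × (EuclideanSpace ℝ (Fin 3))} (hz : parabolicCylinder r z ⊆ parabolicCylinder a (0 : ℝ × (EuclideanSpace ℝ (Fin 3)))) :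
    abScaledSum r z v (fun t x => q t x - ⨍ y in ball (0 : (EuclideanSpace ℝ (Fin 3))) 1, q t y) G = abScaledSum r z v q G := by
  obtain ⟨h32, -, -⟩ := threeHalves_facts
  unfold abScaledSum
  rw [cknDOsc_sub_fun_time_of_integrableOn hr _ ?_]
  have h1 : MemLp (uncurry q) (3 / 2) (volume.restrict (parabolicCylinder r z)) :=
    hq.mono_measure (Measure.restrict_mono hz le_rfl)
  haveI := isFiniteMeasure_restrict_parabolicCylinder r z
  exact (h1.mono_exponent h32).integrable le_rfl

/-- `𝐈(Q(0, a))` is unchanged by the unit-ball-mean normalisation of an `L^{3/2}(Q(0,a))`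
pressure. [cite: AlbrittonBarker2019, §1] -/
theorem typeIBound_sub_unitBallMean_ball {v : ℝ → (EuclideanSpace ℝ (Fin 3)) → (EuclideanSpace ℝ (Fin 3))} {q : ℝ → (EuclideanSpace ℝ (Fin 3)) → ℝ}
    {G : ℝ → (EuclideanSpace ℝ (Fin 3)) → (EuclideanSpace ℝ (Fin 3)) →L[ℝ] (EuclideanSpace ℝ (Fin 3))} {a : ℝ}
    (hq : MemLp (uncurry q) (3 / 2) (volume.restrict (parabolicCylinder a (0 : ℝ × (EuclideanSpace ℝ (Fin 3)))))) :
    typeIBound (parabolicCylinder a (0 : ℝ × (EuclideanSpace ℝ (Fin 3)))) v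
        (fun t x => q t x - ⨍ y in ball (0 : (EuclideanSpace ℝ (Fin 3))) 1, q t y) G =
      typeIBound (parabolicCylinder a (0 : ℝ × (EuclideanSpace ℝ (Fin 3)))) v q G := by
  unfold typeIBound
  refine iSup_congr fun r => iSup_congr fun hr => iSup_congr fun z => iSup_congr fun hz => ?_
  exact abScaledSum_sub_unitBallMean_ball hq hr hz

end Literature.Analysis.FluidPDE.LocalTypeIBlowup

end
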